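import Literature.MathematicalPhysics.QuantumFieldTheory.Balaban1983to89.Setup
import Literature.MathematicalPhysics.QuantumFieldTheory.Balaban1983to89.Beta.GaussianIntegral

/-!
# `Balaban1983to89.B12Eq15QuadraticForm` — T. Bałaban, *Renormalization group approach to lattice gauge field
theories. I*, Commun. Math. Phys. **109** (1987) 249–301 [Balaban1987RG1]: (1.4)–(1.5) p. 260–261, the Gaussian
normalisation `Z^{(j)}(U_k)` and its quadratic form `⟨B, Δ^{(j)}(U_k)B⟩`, TYPED WITH BODIES and their definitional
content PROVED

HONEST FRAMING (cell `lit-balaban`, verbatim): statement-level skeleton of published theorems with citation tags; proofs where landed; nothing here is a claim about the Yang–Mills mass gap.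

PDF held: `paper:balaban1987-cmp109-rg-i-small-field` (journal page = PDF page + 248); read from the page renders
`b2b-balaban-ref1/pages/1987-cmp109-rg-I-small-field/…-p012-x2.png` (p. 260), `…-p013-x2.png` (p. 261),
`…-p019-x2.png` (p. 267) and, for [13] = B9 (3.156), `1985-cmp99-background-propagators-p040-x2.png` (p. 428).

WHAT IS REPRODUCED.  SKELETON row `B12.Eq1.5` (absent before this file; 329 dependants in DEPGRAPH v3), with the
(1.4) half of row `B12.Eq1.4` (whose decl of record is the ABSTRACT slot `Step.SFTower.logZ`) and the sentence of
p. 267 tying (2.11) to (1.5) (row `B12.Eq2.11`, first clause).  THE PRINT, verbatim.  p. 260: *«Let us recall that the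
factor Z^{(j)}(U_k) is given by the Gaussian integral normalizing the Gaussian measure for a fluctuation field in j-th
step integration  Z^{(j)}(U_k) = ∫dB δ(Q̃B) exp[−½⟨B, Δ^{(j)}(U_k)B⟩]. (1.4)»*  p. 261: *«The quadratic form in the
integral is given by  ⟨B, Δ^{(j)}(U_k)B⟩ = ⟨H_{1,j}(U_k)B, Δ₁(U_k)H_{1,j}(U_k)B⟩ − 2⟨H_{1,j}(U_k)hC̃^{(2)}(Ū^j_k, B), J⟩
+ G^{(2)}(B), (1.5)  where the operators H_{1,j}, Δ₁ are defined in Sect. D [13], and C̃^{(2)}(Ū^j_k, B) is the second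
order polynomial in the expansion of Q̃(Ū^j_k, B).»*  p. 267: *«Terms of the order 0 in g_k are
⟨H₁hC̃^{(2)}(B′), J⟩ − ½G^{(2)}(B′) − ½⟨H₁B′, Δ₁H₁B′⟩. (2.11)  The quadratic form in B′ above is equal to
−1/2⟨B′, Δ^{(k)}B′⟩, see the definition (3.156) [13] with the δ-function gauge fixing term replaced by the exponential
one. This quadratic form defines the k-th normalization factor Z^{(k)}(U_{k+1}) given by the formula (1.4) with
j = k.»*  [13] = B9 p. 428: *«⟨B,(QG₁Q*)⁻¹B⟩ − a⟨B,B⟩ − 2⟨H₁D̃^{(2)}(B), J⟩ = ⟨B, Δ_kB⟩. (3.156)»*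

THE TYPING (modelling notes = cell DIVERGENCE rows for this file).
(a) (1.5) is a DEFINITION of the form `Δ^{(j)}(U_k)` from data of [13] Sect. D and B12 §2 at FIXED `k, j, U_k`; the
    tree types Sect. D of [13] the same way (`B9Eq3112`, `B9SectDFP`: "only their matrices at fixed `U` enter").  The
    data (`Data`): `H = H_{1,j}(U_k) : V →ₗ W` (𝔤-valued fields on the bonds carrying `B` ↦ fields on the fine
    lattice), the symmetric pairing `Δ₁ = ⟨·, Δ₁(U_k)·⟩` on `W`, the operator `h : X →ₗ V` of p. 267, the functional
    `⟨·, J⟩` on `W`, and the two "second order polynomials" `C̃^{(2)}(Ū^j_k, ·) : V → X`, `G^{(2)} : V → R` entered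
    through their POLAR (bilinear) forms `C₂`, `G₂` (`C̃^{(2)}(B) = C₂ B B`, `G^{(2)}(B) = G₂ B B`; a homogeneous
    polynomial of degree two IS the diagonal of its polarisation — cf. `B12SecondOrder267`, where `C̃^{(2)}(B)` is
    `(2)⁻¹ • iteratedFDeriv 2 C̃ 0 (B, B)`).  Over any commutative ring `R` (ℝ for (1.4); ℂ for the analytic
    extensions of p. 261).  `Data.form` = the OPERATOR `Δ^{(j)}(U_k)` as a bilinear form (polarised (1.5)),
    `Data.quad B = ⟨B, Δ^{(j)}(U_k)B⟩`; `eq15` is (1.5) VERBATIM for it; `form_symm`, `quad_smul`, `quad_add`,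
    `quadForm` (a Mathlib `QuadraticForm`): it IS a quadratic form; `eq211_quadratic_form` is the p. 267 sentence;
    `eq15_eq_B9_3156` is the [13] dictionary (given the two Sect. D identities it names as hypotheses).
(b) (1.4): `∫dB δ(Q̃B)` ↦ Lebesgue integral over a kernel parametrisation `B = Nz`, `z ∈ ℝ^ρ`, of `{Q̃B = 0}`
    (convention of `B9Eq3112` (3.112)/(3.159), D-b09.56 (b)); `S` = the matrix of `Δ^{(j)}(U_k)` in bond coordinates
    (`form_toMatrix`).  `Z14`, `Z14_eq` (`= (√2π)^{dim}/√det(NᵀSN)`, [pv16's] `Beta.GaussianIntegral`), `Z14_pos`,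
    `logZ14_eq`, and `logZ14_sub`: in the bracket `[log Z^{(j)}(U_k) − log Z^{(j)}(1)]` of (1.3) the `(√2π)^{dim}`
    cancels, leaving `−½[log det(NᵀS(U_k)N) − log det(NᵀS(1)N)]`.  §3 packages U-dependent data into the slot
    `Step.SFTower.logZ : ℕ → GaugeField P 0 G → ℝ` (`NormalizationData.logZ`).
NOT TYPED HERE (and not claimed): the constructions of `H_{1,j}(U_k)`, `Δ₁(U_k)` ([13] Sect. D), `h`, `Q̃`, `C̃`,
`G` (B12 §2) as FUNCTIONS of the background field; the positivity of `Δ^{(j)}(U_k)` on `{Q̃B = 0}` (hypothesis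
`PosDef` where used — the print takes the convergence of (1.4) for granted); the constant Jacobian between
`δ(Q̃B)dB` and `dz` (a `U_k`-independent factor, cancelling in the (1.3) bracket).  No `Prop` placeholder, no new
fact; axioms standard.  Unit `lit-balaban-p07` (Phase-2 seat p07, lead re-point G.5-11), HOME
`run/shared/lean/pub/lit-balaban/`.
-/

namespace Literature.MathematicalPhysics.QuantumFieldTheory.Balaban1983to89.B12Eq15QuadraticForm

noncomputable section

/-! ## §1. (1.5): the quadratic form `⟨B, Δ^{(j)}(U_k)B⟩` from the Sect. D [13] data -/

section Algebra

variable {R : Type*} [CommRing R] {V W X : Type*} [AddCommGroup V] [Module R V] [AddCommGroup W]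
  [Module R W] [AddCommGroup X] [Module R X]

/-- The data of (1.5) at fixed `k`, `j`, `U_k`: `H = H_{1,j}(U_k)`, `Δ₁ = ⟨·, Δ₁(U_k)·⟩` (Sect. D [13]), `hop = h`,
`pairJ = ⟨·, J⟩`, and the polar forms `C₂`, `G₂` of the second-order polynomials `C̃^{(2)}(Ū^j_k, ·)`, `G^{(2)}`.
[cite: Balaban1987RG1, (1.5) p.261] -/
structure Data (R : Type*) [CommRing R] (V W X : Type*) [AddCommGroup V] [Module R V] [AddCommGroup W]
    [Module R W] [AddCommGroup X] [Module R X] where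
  /-- `H_{1,j}(U_k)`, "defined in Sect. D [13]" ((3.126)/(3.129) there). -/
  H : V →ₗ[R] W
  /-- the pairing `⟨A, Δ₁(U_k)A′⟩`, "defined in Sect. D [13]" ((3.127)–(3.128) there). -/
  Δ₁ : W →ₗ[R] W →ₗ[R] R
  /-- the operator `h` of p. 267 (`LQ̃h = I`; from the bonds of `T^{(k+1)}` to the bonds carrying `B`). -/
  hop : X →ₗ[R] V
  /-- polar form of `C̃^{(2)}(Ū^j_k, ·)`, "the second order polynomial in the expansion of `Q̃(Ū^j_k, B)`". -/
  C₂ : V →ₗ[R] V →ₗ[R] X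
  /-- the functional `⟨·, J⟩`, `J = J_k` of (1.2)/(1.8). -/
  pairJ : W →ₗ[R] R
  /-- polar form of `G^{(2)}`, the second-order part of the exponential gauge-fixing function `G` of (2.10). -/
  G₂ : V →ₗ[R] V →ₗ[R] R

namespace Data

variable (D : Data R V W X)

/-- `C̃^{(2)}(Ū^j_k, B) = C₂ B B`. [cite: Balaban1987RG1, (1.5) p.261] -/
def Ctwo (B : V) : X := D.C₂ B B

/-- `G^{(2)}(B) = G₂ B B`. [cite: Balaban1987RG1, (1.5) p.261] -/
def Gtwo (B : V) : R := D.G₂ B B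

/-- **The operator `Δ^{(j)}(U_k)`** as a bilinear form on the `B`-fields: (1.5) polarised,
`⟨B₁, Δ^{(j)}(U_k)B₂⟩ = ⟨H B₁, Δ₁ H B₂⟩ − 2⟨H h C₂(B₁, B₂), J⟩ + G₂(B₁, B₂)`. [cite: Balaban1987RG1, (1.5) p.261] -/
def form : V →ₗ[R] V →ₗ[R] R :=
  D.Δ₁.compl₁₂ D.H D.H - (2 : R) • D.C₂.compr₂ (D.pairJ ∘ₗ D.H ∘ₗ D.hop) + D.G₂

/-- **`⟨B, Δ^{(j)}(U_k)B⟩`**, the quadratic form of (1.4)–(1.5). [cite: Balaban1987RG1, (1.5) p.261] -/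
def quad (B : V) : R := D.form B B

/-- The polarised (1.5), unfolded. [cite: Balaban1987RG1, (1.5) p.261] -/
theorem form_apply (B₁ B₂ : V) :
    D.form B₁ B₂ = D.Δ₁ (D.H B₁) (D.H B₂) - 2 * D.pairJ (D.H (D.hop (D.C₂ B₁ B₂))) + D.G₂ B₁ B₂ := by
  simp only [form, LinearMap.add_apply, LinearMap.sub_apply, LinearMap.smul_apply, LinearMap.compl₁₂_apply,
    LinearMap.compr₂_apply, LinearMap.coe_comp, Function.comp_apply, smul_eq_mul]

/-- **(1.5) verbatim**: *«⟨B, Δ^{(j)}(U_k)B⟩ = ⟨H_{1,j}(U_k)B, Δ₁(U_k)H_{1,j}(U_k)B⟩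
− 2⟨H_{1,j}(U_k)hC̃^{(2)}(Ū^j_k, B), J⟩ + G^{(2)}(B)»*. [cite: Balaban1987RG1, (1.5) p.261] -/
theorem eq15 (B : V) :
    D.quad B = D.Δ₁ (D.H B) (D.H B) - 2 * D.pairJ (D.H (D.hop (D.Ctwo B))) + D.Gtwo B :=
  D.form_apply B B

/-- `Δ^{(j)}(U_k)` is symmetric when `Δ₁`, `C₂`, `G₂` are (polar forms are symmetric by construction).
[cite: Balaban1987RG1, (1.5) p.261] -/
theorem form_symm (hΔ : ∀ x y, D.Δ₁ x y = D.Δ₁ y x) (hC : ∀ x y, D.C₂ x y = D.C₂ y x)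
    (hG : ∀ x y, D.G₂ x y = D.G₂ y x) (B₁ B₂ : V) : D.form B₁ B₂ = D.form B₂ B₁ := by
  rw [form_apply, form_apply, hΔ, hC, hG]

/-- "quadratic form": homogeneity of degree two. [cite: Balaban1987RG1, (1.5) p.261] -/
theorem quad_smul (c : R) (B : V) : D.quad (c • B) = c ^ 2 * D.quad B := by
  simp only [quad, map_smul, LinearMap.smul_apply, smul_eq_mul]
  ring

/-- "quadratic form": the parallelogram/polarisation identity. [cite: Balaban1987RG1, (1.5) p.261] -/
theorem quad_add (B₁ B₂ : V) :
    D.quad (B₁ + B₂) = D.quad B₁ + D.quad B₂ + (D.form B₁ B₂ + D.form B₂ B₁) := by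
  simp only [quad, map_add, LinearMap.add_apply]
  abel

/-- `⟨B, Δ^{(j)}(U_k)B⟩` as a Mathlib `QuadraticForm`. [cite: Balaban1987RG1, (1.5) p.261] -/
def quadForm : QuadraticForm R V := LinearMap.BilinMap.toQuadraticMap D.form

/-- [cite: Balaban1987RG1, (1.5) p.261] -/
theorem quadForm_apply (B : V) : D.quadForm B = D.quad B :=
  LinearMap.BilinMap.toQuadraticMap_apply _ _

/-- **The [13] dictionary** (p. 267: (1.5) is *«the definition (3.156) [13] with the δ-function gauge fixing term
replaced by the exponential one»*).  [13] (3.156) reads `⟨B,(QG₁Q*)⁻¹B⟩ − a⟨B,B⟩ − 2⟨H₁D̃^{(2)}(B), J⟩ = ⟨B, Δ_kB⟩`;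
given the two Sect. D identities `⟨H₁B, G₁⁻¹H₁B⟩ = ⟨B, (QG₁Q*)⁻¹B⟩` (tree: `B9Eq3112.eq_3156_energy`) and
`⟨H₁B, G₁⁻¹H₁B⟩ = ⟨H₁B, Δ₁H₁B⟩ + a⟨B, B⟩` (`G₁⁻¹ = Δ₁ + DRD* + Q*aQ` on `H₁B`, where `RD*H₁B = 0`, `QH₁B = B`:
[13] (3.124), (3.128)), the form (1.5) is (3.156) plus the exponential gauge-fixing term `G^{(2)}(B)`
(with `D̃^{(2)} = C̃^{(2)}`, p. 267). [cite: Balaban1987RG1, (1.5) p.261] -/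
theorem eq15_eq_B9_3156 (Ginv : W →ₗ[R] W →ₗ[R] R) (ip : V →ₗ[R] V →ₗ[R] R) (P : V →ₗ[R] V) (a : R)
    (h3156 : ∀ B, Ginv (D.H B) (D.H B) = ip B (P B))
    (hG : ∀ B, Ginv (D.H B) (D.H B) = D.Δ₁ (D.H B) (D.H B) + a * ip B B) (B : V) :
    D.quad B = ip B (P B) - a * ip B B - 2 * D.pairJ (D.H (D.hop (D.Ctwo B))) + D.Gtwo B := by
  rw [eq15]
  linear_combination h3156 B - hG B

end Data

/-- **p. 267, the sentence after (2.11)**: *«Terms of the order 0 in g_k are ⟨H₁hC̃^{(2)}(B′), J⟩ − ½G^{(2)}(B′) −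
½⟨H₁B′, Δ₁H₁B′⟩. (2.11) The quadratic form in B′ above is equal to −1/2⟨B′, Δ^{(k)}B′⟩»* — for the form (1.5)
(`j = k`; over a field of characteristic zero, e.g. ℝ or ℂ). [cite: Balaban1987RG1, (2.11) p.267] -/
theorem eq211_quadratic_form {𝕜 : Type*} [Field 𝕜] [CharZero 𝕜] {V W X : Type*} [AddCommGroup V] [Module 𝕜 V]
    [AddCommGroup W] [Module 𝕜 W] [AddCommGroup X] [Module 𝕜 X] (D : Data 𝕜 V W X) (B' : V) :
    D.pairJ (D.H (D.hop (D.Ctwo B'))) - (1 / 2 : 𝕜) * D.Gtwo B' - (1 / 2 : 𝕜) * D.Δ₁ (D.H B') (D.H B')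
      = -(1 / 2 : 𝕜) * D.quad B' := by
  rw [Data.eq15]
  ring

end Algebra

/-! ## §2. (1.4): the Gaussian normalisation `Z^{(j)}(U_k) = ∫dB δ(Q̃B) exp[−½⟨B, Δ^{(j)}(U_k)B⟩]` -/

section Normalization

open _root_.Matrix _root_.MeasureTheory

variable {ι ρ : Type*} [Fintype ι] [Fintype ρ]

/-- The matrix `S` of a bilinear form `Φ` on `ℝ^ι` in bond coordinates represents it: `Bᵀ S B′ = Φ(B, B′)`
(Mathlib `LinearMap.toMatrix₂'`). [folklore] -/
private theorem form_toMatrix [DecidableEq ι] (Φ : (ι → ℝ) →ₗ[ℝ] (ι → ℝ) →ₗ[ℝ] ℝ) (B B' : ι → ℝ) :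
    B ⬝ᵥ (LinearMap.toMatrix₂' ℝ Φ) *ᵥ B' = Φ B B' := by
  rw [← Matrix.toLinearMap₂'_apply', Matrix.toLinearMap₂'_toMatrix']

/-- **(1.4)**, `Z^{(j)}(U_k) = ∫dB δ(Q̃B) exp[−½⟨B, Δ^{(j)}(U_k)B⟩]`, in coordinates: `S` = the matrix of
`Δ^{(j)}(U_k)` on `ℝ^ι` (the `B`-bonds), `N : ℝ^ρ → ℝ^ι` a parametrisation `B = Nz` of `{Q̃B = 0}` (the δ-function),
`dz` Lebesgue. [cite: Balaban1987RG1, (1.4) p.260] -/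
def Z14 (S : Matrix ι ι ℝ) (N : Matrix ι ρ ℝ) : ℝ :=
  ∫ z : ρ → ℝ, Real.exp (-(1 / 2 : ℝ) * ((N *ᵥ z) ⬝ᵥ S *ᵥ (N *ᵥ z)))

/-- (1.4) for the form (1.5) itself (`V = ℝ^ι`): the integrand is `exp[−½⟨Nz, Δ^{(j)}(U_k)Nz⟩]`.
[cite: Balaban1987RG1, (1.4) p.260] -/
theorem Z14_form [DecidableEq ι] {W X : Type*} [AddCommGroup W] [Module ℝ W] [AddCommGroup X] [Module ℝ X]
    (D : Data ℝ (ι → ℝ) W X) (N : Matrix ι ρ ℝ) :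
    Z14 (LinearMap.toMatrix₂' ℝ D.form) N = ∫ z : ρ → ℝ, Real.exp (-(1 / 2 : ℝ) * D.quad (N *ᵥ z)) := by
  simp only [Z14, form_toMatrix, Data.quad]

/-- The restricted form in the coordinates `z`: `⟨Nz, S Nz⟩ = ⟨z, (NᵀSN)z⟩`. [folklore] -/
private theorem quadForm_kernel (S : Matrix ι ι ℝ) (N : Matrix ι ρ ℝ) (z : ρ → ℝ) :
    (N *ᵥ z) ⬝ᵥ S *ᵥ (N *ᵥ z) = z ⬝ᵥ (Nᵀ * S * N) *ᵥ z := by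
  rw [Matrix.mul_assoc, ← mulVec_mulVec, ← mulVec_mulVec, dotProduct_mulVec _ Nᵀ, vecMul_transpose]

/-- **(1.4) in closed form**: if `Δ^{(j)}(U_k)` is positive definite on `{Q̃B = 0}` (`NᵀSN > 0`), then
`Z^{(j)}(U_k) = (√2π)^{dim}/√det(NᵀSN)`. [cite: Balaban1987RG1, (1.4) p.260] -/
theorem Z14_eq [DecidableEq ρ] (S : Matrix ι ι ℝ) (N : Matrix ι ρ ℝ) (hpos : (Nᵀ * S * N).PosDef) :
    Z14 S N = Real.sqrt (2 * Real.pi) ^ Fintype.card ρ / Real.sqrt (Nᵀ * S * N).det := by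
  unfold Z14
  simp_rw [quadForm_kernel]
  exact Beta.GaussianIntegral.integral_exp_neg_half_quadForm _ hpos

/-- `Z^{(j)}(U_k) > 0`, so `log Z^{(j)}(U_k)` in (1.3) is a genuine logarithm. [cite: Balaban1987RG1, (1.4) p.260] -/
theorem Z14_pos [DecidableEq ρ] (S : Matrix ι ι ℝ) (N : Matrix ι ρ ℝ) (hpos : (Nᵀ * S * N).PosDef) : 0 < Z14 S N := by
  rw [Z14_eq S N hpos]
  exact div_pos (pow_pos (Real.sqrt_pos.mpr (by positivity)) _) (Real.sqrt_pos.mpr hpos.det_pos)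

/-- `log Z^{(j)}(U_k)` — the zeroth-order term of (1.3). [cite: Balaban1987RG1, (1.3)–(1.4) p.260] -/
def logZ14 (S : Matrix ι ι ℝ) (N : Matrix ι ρ ℝ) : ℝ := Real.log (Z14 S N)

/-- `log Z^{(j)}(U_k) = (dim/2)·log 2π − ½ log det(NᵀSN)`. [cite: Balaban1987RG1, (1.3)–(1.4) p.260] -/
theorem logZ14_eq [DecidableEq ρ] (S : Matrix ι ι ℝ) (N : Matrix ι ρ ℝ) (hpos : (Nᵀ * S * N).PosDef) :
    logZ14 S N = (Fintype.card ρ : ℝ) * (Real.log (2 * Real.pi) / 2)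
      - Real.log (Nᵀ * S * N).det / 2 := by
  have h2pi : 0 < Real.sqrt (2 * Real.pi) := Real.sqrt_pos.mpr (by positivity)
  have hdet : 0 < Real.sqrt (Nᵀ * S * N).det := Real.sqrt_pos.mpr hpos.det_pos
  rw [logZ14, Z14_eq S N hpos, Real.log_div (pow_ne_zero _ h2pi.ne') hdet.ne', Real.log_pow,
    Real.log_sqrt (by positivity), Real.log_sqrt hpos.det_pos.le]

/-- **The zeroth-order bracket of (1.3)**, `[log Z^{(j)}(U_k) − log Z^{(j)}(1)]`: for two background fields with
the same constraint parametrisation `N` the volume factors cancel and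
`log Z^{(j)}(U_k) − log Z^{(j)}(1) = −½[log det(NᵀS(U_k)N) − log det(NᵀS(1)N)]`.
[cite: Balaban1987RG1, (1.3)–(1.4) p.260] -/
theorem logZ14_sub [DecidableEq ρ] (S₁ S₀ : Matrix ι ι ℝ) (N : Matrix ι ρ ℝ) (h₁ : (Nᵀ * S₁ * N).PosDef)
    (h₀ : (Nᵀ * S₀ * N).PosDef) :
    logZ14 S₁ N - logZ14 S₀ N
      = -(1 / 2 : ℝ) * (Real.log (Nᵀ * S₁ * N).det - Real.log (Nᵀ * S₀ * N).det) := by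
  rw [logZ14_eq S₁ N h₁, logZ14_eq S₀ N h₀]
  ring

end Normalization

/-! ## §3. The slot `Step.SFTower.logZ : ℕ → GaugeField P 0 G → ℝ` filled by (1.4)–(1.5) -/

section StepSlot

open _root_.Matrix

/-- Background-field-dependent (1.4)–(1.5) data for every step `j`: the bond index set `ι j` of the `j`-th
fluctuation field `B`, kernel coordinates `ρ j` of `{Q̃B = 0}`, the matrix `S j U` of `Δ^{(j)}(U)` and the
parametrisation `N j U` of the constraint. [cite: Balaban1987RG1, (1.4)–(1.5) pp.260–261] -/
structure NormalizationData (P : Params) (G : Type*) where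
  /-- bond index set of the `j`-th fluctuation field -/
  ι : ℕ → Type
  /-- coordinates of `{Q̃B = 0}` at step `j` -/
  ρ : ℕ → Type
  /-- finiteness of the lattices -/
  fintypeι : ∀ j, Fintype (ι j)
  /-- finiteness of the constraint coordinates -/
  fintypeρ : ∀ j, Fintype (ρ j)
  /-- decidable equality of the constraint coordinates (for determinants) -/
  decEqρ : ∀ j, DecidableEq (ρ j)
  /-- the matrix of `Δ^{(j)}(U)` ((1.5)) in bond coordinates -/
  S : (j : ℕ) → GaugeField P 0 G → Matrix (ι j) (ι j) ℝ
  /-- the parametrisation `B = Nz` of `{Q̃B = 0}` -/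
  N : (j : ℕ) → GaugeField P 0 G → Matrix (ι j) (ρ j) ℝ

namespace NormalizationData

variable {P : Params} {G : Type*}

attribute [instance] NormalizationData.fintypeι NormalizationData.fintypeρ NormalizationData.decEqρ

/-- `log Z^{(j)}(U)` by (1.4) — a term of the shape of the field `Step.SFTower.logZ`.
[cite: Balaban1987RG1, (1.4) p.260] -/
def logZ (D : NormalizationData P G) (j : ℕ) (U : GaugeField P 0 G) : ℝ := logZ14 (D.S j U) (D.N j U)

/-- The (1.3) bracket for this slot: with a `U`-independent constraint parametrisation,
`log Z^{(j)}(U) − log Z^{(j)}(1) = −½[log det(NᵀS(U)N) − log det(NᵀS(1)N)]`.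
[cite: Balaban1987RG1, (1.3)–(1.4) p.260] -/
theorem logZ_sub_logZ_one [GaugeGroup G] (D : NormalizationData P G) (j : ℕ) (U : GaugeField P 0 G)
    (hN : D.N j U = D.N j 1) (hU : ((D.N j U)ᵀ * D.S j U * D.N j U).PosDef)
    (h1 : ((D.N j 1)ᵀ * D.S j 1 * D.N j 1).PosDef) :
    D.logZ j U - D.logZ j 1 = -(1 / 2 : ℝ) *
      (Real.log ((D.N j U)ᵀ * D.S j U * D.N j U).det - Real.log ((D.N j 1)ᵀ * D.S j 1 * D.N j 1).det) := by
  simp only [logZ]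
  rw [hN] at hU ⊢
  exact logZ14_sub _ _ _ hU h1

end NormalizationData

end StepSlot

end

end Literature.MathematicalPhysics.QuantumFieldTheory.Balaban1983to89.B12Eq15QuadraticForm
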